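import Literature.NumberTheory.EllipticCurves.TwoTorsionGaloisActionProofs
import Literature.NumberTheory.EllipticCurves.GoodReductionUnramifiedProofs
import Literature.NumberTheory.EllipticCurves.GeomPointsGaloisModule
import Literature.NumberTheory.EllipticCurves.GreenbergSelmer
import Literature.NumberTheory.EllipticCurves.ZpExtensionUnramifiedProofs
import Literature.NumberTheory.GaloisRepresentations.DecompositionGroupOfCompletion
import Mathlib.GroupTheory.Perm.Sign
import Mathlib.Topology.Algebra.OpenSubgroup
import HarnessLib

/-!
# The even subgroup `N = ρ̄⁻¹(A₃) ≤ Γ_ℚ` of `W[2]`: it is OPEN, and it contains the inertia group `I_v` of every place `v ∤ 2` of good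
# reduction — hypotheses `IsOpen N` and (N2) of the global transfer package for `(R≥)ᵖ`
# (lead prover bsd-wall-rtt-p2 g10; `--supports stmt-BirchSwinnertonDyer-26074`; route-independent, closes nothing)

HONEST FRAMING. THEOREMS ONLY (no definition, no named fact, no instance, no `sorry`); nothing about any Selmer group is asserted; BSD is
not proved by any of this. No route (`Theses`) file is imported.

WHAT (`W/ℚ` elliptic; `ρ̄(σ) = DokchitserDokchitser2012.permGal W h2 σ ∈ S₃`; `N ≤ Γ_ℚ` with `σ ∈ N ↔ sign ρ̄(σ) = 1`):
* `permGal_eq_one_of_forall_smul_T_eq` — an element fixing `T₀, T₁, T₂` has `ρ̄ = 1`;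
* `isOpen_of_even` — `N` is open (it contains the open subgroup `⋂ᵢ Stab(T_i)`, tree `isOpen_stabilizer_geomTorsion`);
* `inertia_le_of_even` — **(N2)** `GreenbergSelmer.inertia v ≤ N` for every `v ∤ 2` of good reduction (`I_v` acts trivially on `E[2]`:
  Silverman VII.4.1(a), tree `smul_geomTorsion_eq_of_mem_inertia`); so with `S₀ ⊇ bad(W)` the hypothesis of
  `ResidualLayer.mem_unramifiedOutside_kerSubgroup_iff_resOfLe_inf_mem` (p619843) holds for every `v ∉ S₀`, `v ∤ 2`:
  `inertia_le_of_even_of_not_mem`.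
Companion of `…ResidualEvenSubgroup` ((N1), (E1), (E2), (C1), (C2)); memo `Cruxes/ResidualThetaCountLowerPureAtTwo/LAMBDA-INEQ-g10.md` §5.

References: [SilvermanAEC2009] Prop. VII.4.1(a), III.§7; [NeukirchANT1999] Ch. II §9 Prop. (9.6).
-/

set_option autoImplicit false
-- D-0017: single-problem summit, so `Summit.BirchSwinnertonDyer.BirchSwinnertonDyer.…` repeats a namespace BY DESIGN.
set_option linter.dupNamespace false

noncomputable section

open scoped Classical

open Equiv WeierstrassCurve NumberField IsDedekindDomain Field Literature.NumberTheory.EllipticCurves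
  Literature.NumberTheory.EllipticCurves.GreenbergSelmer Literature.NumberTheory.EllipticCurves.DokchitserDokchitser2012
  Literature.NumberTheory.GaloisRepresentations

namespace Summit.BirchSwinnertonDyer.BirchSwinnertonDyer.Theorems.ResidualLayer

variable (W : WeierstrassCurve ℚ) [W.IsElliptic] (h2 : (2 : ℚ) ≠ 0)

/-- An element of `Γ_ℚ` fixing the three nonzero `2`-torsion points induces the identity permutation. [cite: SilvermanAEC2009, III.§7] -/
theorem permGal_eq_one_of_forall_smul_T_eq {σ : absoluteGaloisGroup ℚ} (hσ : ∀ i : Fin 3, σ • T W h2 i = T W h2 i) :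
    permGal W h2 σ = 1 :=
  Equiv.ext fun i ↦ T_injective W h2 (by rw [T_permGal, hσ i, Perm.one_apply])

/-- **The even subgroup is OPEN**: it contains `Stab(T₀) ∩ Stab(T₁) ∩ Stab(T₂)`, an open subgroup of `Γ_ℚ`
(`isOpen_stabilizer_geomTorsion`). [cite: SilvermanAEC2009, III.§7] -/
theorem isOpen_of_even (N : Subgroup (absoluteGaloisGroup ℚ)) (hN : ∀ σ, σ ∈ N ↔ Perm.sign (permGal W h2 σ) = 1) :
    IsOpen (N : Set (absoluteGaloisGroup ℚ)) := by
  let S : Subgroup (absoluteGaloisGroup ℚ) :=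
    (MulAction.stabilizer (absoluteGaloisGroup ℚ) (T W h2 0) ⊓ MulAction.stabilizer (absoluteGaloisGroup ℚ) (T W h2 1)) ⊓
      MulAction.stabilizer (absoluteGaloisGroup ℚ) (T W h2 2)
  have hS : IsOpen (S : Set (absoluteGaloisGroup ℚ)) := by
    simp only [S, Subgroup.coe_inf]
    exact ((isOpen_stabilizer_geomTorsion W 2 _).inter (isOpen_stabilizer_geomTorsion W 2 _)).inter
      (isOpen_stabilizer_geomTorsion W 2 _)
  refine Subgroup.isOpen_mono (H₁ := S) (fun σ hσ ↦ ?_) hS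
  obtain ⟨⟨h0, h1⟩, h3⟩ := hσ
  rw [hN, permGal_eq_one_of_forall_smul_T_eq W h2, Perm.sign_one]
  intro i
  fin_cases i
  · exact h0
  · exact h1
  · exact h3

/-- **(N2) `I_v ≤ N` for `v ∤ 2` of good reduction**: the inertia group `GreenbergSelmer.inertia v` (= `I_{𝔓₀}` for the tree's chosen
prime `𝔓₀ = adicCompletionPrime ℚ v`, Neukirch II (9.6)) acts trivially on `E[2]` (Silverman VII.4.1(a),
`smul_geomTorsion_eq_of_mem_inertia`), hence is even. [cite: SilvermanAEC2009, Prop. VII.4.1(a)] [cite: NeukirchANT1999, Ch. II §9 Prop. (9.6)] -/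
theorem inertia_le_of_even (N : Subgroup (absoluteGaloisGroup ℚ)) (hN : ∀ σ, σ ∈ N ↔ Perm.sign (permGal W h2 σ) = 1)
    {v : HeightOneSpectrum (𝓞 ℚ)} (hv : W.HasGoodReductionAt v) (h2v : ((2 : ℤ) : 𝓞 ℚ) ∉ v.asIdeal) :
    inertia v ≤ N := by
  intro x hx
  obtain ⟨τ, hτ, rfl⟩ := hx
  have hτ' : absGaloisRestrict ℚ (v.adicCompletion ℚ) τ ∈
      (adicCompletionPrime ℚ v).inertia (absoluteGaloisGroup ℚ) := by
    rw [inertia_adicCompletionPrime_eq_map_absInertia]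
    exact Subgroup.mem_map_of_mem _ hτ
  rw [hN, permGal_eq_one_of_forall_smul_T_eq W h2, Perm.sign_one]
  intro i
  exact W.smul_geomTorsion_eq_of_mem_inertia hv h2v (adicCompletionPrime_mem_primesAbove ℚ v) hτ' _

/-- **(N2) in the crux's form**: with `S₀ ⊇ bad(W)`, `I_v ≤ N` for every `v ∉ S₀` with `2 ∉ v` — the hypothesis `hN` of
`ResidualLayer.mem_unramifiedOutside_kerSubgroup_iff_resOfLe_inf_mem` (p619843) at `p = 2`. [cite: SilvermanAEC2009, Prop. VII.4.1(a)] -/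
theorem inertia_le_of_even_of_not_mem (N : Subgroup (absoluteGaloisGroup ℚ)) (hN : ∀ σ, σ ∈ N ↔ Perm.sign (permGal W h2 σ) = 1)
    (S₀ : Set (HeightOneSpectrum (𝓞 ℚ))) (hS : ∀ v : HeightOneSpectrum (𝓞 ℚ), ¬ W.HasGoodReductionAt v → v ∈ S₀) :
    ∀ v : HeightOneSpectrum (𝓞 ℚ), v ∉ S₀ → ((2 : ℕ) : 𝓞 ℚ) ∉ v.asIdeal → inertia v ≤ N := by
  intro v hv h2v
  have hgood : W.HasGoodReductionAt v := by
    by_contra h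
    exact hv (hS v h)
  exact inertia_le_of_even W h2 N hN hgood (by exact_mod_cast h2v)

end Summit.BirchSwinnertonDyer.BirchSwinnertonDyer.Theorems.ResidualLayer

end
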